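import Literature.AnabelianGeometry.EtaleTheta.TowerOfSetting
import Literature.AnabelianGeometry.EtaleTheta.RigidOfSetting
import Literature.AnabelianGeometry.EtaleTheta.Discharge.Sec2ReductionProofs
import Literature.AnabelianGeometry.EtaleTheta.Discharge.Sec2BiThetaSystemsProofs
import Literature.AnabelianGeometry.EtaleTheta.Discharge.Sec2DiscreteRigidityLevels
import Literature.AnabelianGeometry.EtaleTheta.Discharge.Sec2LiftingProofs
import Literature.AnabelianGeometry.EtaleTheta.Discharge.Sec2CyclotomicRigidityTempSlim
import Literature.AnabelianGeometry.EtaleTheta.Discharge.Sec2DiscreteRigidityStrong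
import Literature.AlgebraicGeometry.Frobenioids.Categories
import Literature.NumberTheory.GaloisRepresentations.KummerCocycleLifting
import Literature.FieldTheory.Galois.FixingSubgroupAbsoluteGalois
import HarnessLib

/-!
# [EtTh] §2 discharge for the §1 MODEL: Kummer lifting, hence Cor. 2.18 (iv) (reduction) and
# Cor. 2.19 (ii) (discrete rigidity) for the tower of theta-environment data of `X̲̲`

Mochizuki, *The Étale Theta Function …* [EtTh], Publ. RIMS 45 (2009), §2: Cor. 2.18 (iv) p.61
("`M_{M'}` … induces … `M_M`"), Cor. 2.19 (ii) pp.64–66 (locators `p.N` = PDF pages of the PRIMS text;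
bib key `MochizukiEtTh2009`). PROOF-ONLY companion (no `def`, no new named fact; seat abc-iut-L2-d1,
DAG node `EtTh:Cor2.19(ii)`, LONG-CHAINS lane C2) of `TowerOfSetting.lean` (seat abc-iut-L2-t8: the
tower `DoubleUnderline.thetaEnvTower C τ hC hS` INSTANTIATED from the §1 theta setting) and of
`Discharge/Sec2ReductionProofs.lean` (abc-iut-L2-d1 gen 0: `ThetaEnvTower.cor218_iv_reduction_of`,
`cor219_ii_of_tempSlim_kummerLift`, conditional on "temp-slimness" and "Kummer lifting").

What is proved here:

* `ThetaSetting.exists_kummer_lift_GK` — **Kummer lifting on `G_K`** for the theta setting: a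
  `1`-cocycle `δ : G_K → μ_M` (`G_K = K.fixingSubgroup ≤ G_{ℚ_p}`, `μ_M ⊆ ℚ̄_p^×` with the Galois action)
  with open kernel lifts along `ζ ↦ ζ^{M'/M}` to a continuous `1`-cocycle `G_K → μ_{M'}` — the tree's
  Kummer-theoretic lifting (`KummerCocycleLifting.lean`, over continuous Hilbert 90) transported along
  the homeomorphism `G_K ≃ₜ* Aut_K(ℚ̄_p)` of `FixingSubgroupAbsoluteGalois.lean`;
* `DoubleUnderline.kummerLift_thetaEnvTower` — the hypothesis `(hKL)` ("Kummer lifting") of the gen-0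
  discharge HOLDS for the model tower, GIVEN that `Π^tp_X → G_K` is an OPEN map (`haugOpen`, see below);
* `DoubleUnderline.tempSlim_Huu` — temp-slimness of `Π^tp_X` (`IsSlimGroup`, the interface FACT
  "[SemiAnbd] Ex. 3.10") restricts to the open subgroup `Π^tp_X̲̲`;
* `DoubleUnderline.cor218_iv_reduction_model`, `DoubleUnderline.cor219_ii_model` — **Cor. 2.18 (iv)
  (reduction clause) and Cor. 2.19 (ii) (discrete rigidity) FOR THE §1 MODEL TOWER**, modulo exactly:
  temp-slimness of `Π^tp_X`; `haugOpen`; and (for 2.19 (ii)) the level-wise Cor. 2.18 (iv) named facts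
  `Cor218_iv_surjective` (⟸ Cor. 2.18 (i) + constant multiple rigidity, FACT-policy, see
  `Sec2LiftingSurjProofs.lean`) and `Cor218_iv_fibre` clause 1 (⟸ Prop. 2.14 (i), `Sec2LiftingProofs`).

READING NOTE on `haugOpen` (an INTERFACE input, reported to the interface owners): [SemiAnbd] p.69 /
[EtTh] p.11 speak of "the natural exact sequence `1 → Δ^tp_X → Π^tp_X → G_K → 1`" of topological
groups; the tree's `SemiGraphs.TemperedCurve` records continuity and the image of `Π^tp_X → G_{ℚ_p}` but
not that `Π^tp_X → G_{ℚ_p}` is an open map (equivalently — `G_K` being open in `G_{ℚ_p}` — that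
`Π^tp_X → G_K` is open, i.e. that `G_K` carries the quotient topology). Without it the
continuity of a Kummer class on `Π^tp_Y` does not descend to `G_K`, which Hilbert 90 needs; so it is
carried as an explicit hypothesis. HONEST FRAMING: conditional discharge modulo the inputs listed; no
side is taken on [IUTchIII] Cor. 3.12; typed ≠ discharged elsewhere.
-/

noncomputable section

namespace Literature.AnabelianGeometry.EtaleTheta

open Literature.AnabelianGeometry.SemiGraphs
open Literature.AlgebraicGeometry.Frobenioids (IsSlimGroup)
open Literature.NumberTheory.GaloisRepresentations
open Literature.FieldTheory.Galois

namespace ThetaSetting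

variable {p : ℕ} [Fact p.Prime] (D : ThetaSetting p)

/-! ## Kummer lifting on `G_K ≤ G_{ℚ_p}` -/

/-- **Kummer lifting on `G_K`** for the theta setting: for `M ∣ M'`, every `1`-cocycle
`δ : G_K → μ_M` (for the Galois action on the `M`-th roots of unity of `ℚ̄_p`;
`δ(gh) = δ(g) · g(δ(h))`) with open kernel is the image under the power map `μ_{M'} ↠ μ_M`,
`ζ ↦ ζ^{M'/M}`, of a continuous `1`-cocycle `δ' : G_K → μ_{M'}` — Kummer theory
`H¹(G_K, μ_n) = K^×/K^{×n}` with `K^×/K^{×M'} ↠ K^×/K^{×M}` (the tree's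
`AlgEquiv.exists_rootsOfUnity_cocycle_lift`), transported along `G_K ≃ₜ* Aut_K(ℚ̄_p)`.
[cite: MochizukiEtTh2009, Def 2.13 (i) p.47] -/
theorem exists_kummer_lift_GK {M M' : ℕ+} (h : (M : ℕ) ∣ M') (δ : D.GK → MuN p M)
    (hδ : ∀ g g' : D.GK, δ (g * g') = δ g * galMuN p M (g : GQp p) (δ g'))
    (hopen : IsOpen {g | δ g = 1}) :
    ∃ δ' : D.GK → MuN p M', (∀ g g' : D.GK, δ' (g * g') = δ' g * galMuN p M' (g : GQp p) (δ' g')) ∧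
      Continuous δ' ∧ ∀ g, MuN.red p M M' h (δ' g) = δ g := by
  haveI : FiniteDimensional ℚ_[p] D.K := D.finiteDimensional_K
  -- `G_K ≃ₜ* Aut_K(ℚ̄_p)` (Krull topologies)
  let Φ : D.GK ≃ₜ* (PadicAlgCl p ≃ₐ[D.K] PadicAlgCl p) :=
    fixingSubgroupContinuousMulEquiv D.K (AlgEquiv.refl : PadicAlgCl p ≃ₐ[D.K] PadicAlgCl p)
  have hΦ : ∀ (g : D.GK) (y : PadicAlgCl p), Φ g y = (g : GQp p) y := fun g y => rfl
  have hΦsymm : ∀ (σ : PadicAlgCl p ≃ₐ[D.K] PadicAlgCl p) (y : PadicAlgCl p),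
      ((Φ.symm σ : D.GK) : GQp p) y = σ y := fun σ y => by
    rw [← hΦ, Φ.apply_symm_apply]
  -- the action of `g ∈ G_K` on `μ_M` is the action of `Φ g` on units
  have hact : ∀ (N : ℕ+) (g : D.GK) (ζ : MuN p N),
      ((galMuN p N (g : GQp p) ζ : MuN p N) : (PadicAlgCl p)ˣ) = Φ g • (ζ : (PadicAlgCl p)ˣ) := by
    intro N g ζ
    refine Units.ext ?_
    rw [galMuN_apply_coe, AlgEquiv.smul_units_def, Units.coe_map, MonoidHom.coe_coe, hΦ]
  -- transport `δ` to `Aut_K(ℚ̄_p)`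
  set δ₁ : (PadicAlgCl p ≃ₐ[D.K] PadicAlgCl p) → rootsOfUnity M (PadicAlgCl p) :=
    fun σ => δ (Φ.symm σ) with hδ₁
  have hδ₁c : ∀ σ σ', ((δ₁ (σ * σ') : (PadicAlgCl p)ˣ)) = σ • (δ₁ σ' : (PadicAlgCl p)ˣ) * δ₁ σ := by
    intro σ σ'
    simp only [hδ₁, map_mul, hδ, Subgroup.coe_mul, hact, Φ.apply_symm_apply]
    rw [mul_comm]
  have hopen₁ : IsOpen {σ | δ₁ σ = 1} := hopen.preimage (map_continuous Φ.symm)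
  obtain ⟨δ₁', hδ₁'c, -, hlc, hpow⟩ :=
    AlgEquiv.exists_rootsOfUnity_cocycle_lift M'.pos h δ₁ hδ₁c hopen₁
  refine ⟨fun g => δ₁' (Φ g), fun g g' => ?_, hlc.continuous.comp (map_continuous Φ), fun g => ?_⟩
  · apply Subtype.ext
    dsimp only
    rw [map_mul, Subgroup.coe_mul, hact, hδ₁'c, mul_comm]
  · apply Subtype.ext
    rw [MuN.coe_red]
    dsimp only
    rw [hpow, hδ₁]
    dsimp only
    rw [Φ.symm_apply_apply]

end ThetaSetting

/-! ## The model tower -/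

namespace ThetaSetting.EtaleThetaData.DoubleUnderline

variable {p : ℕ} [Fact p.Prime] {D : ThetaSetting p} {E : D.EtaleThetaData} {l : ℕ}
  (C : E.DoubleUnderline l) {Es : Set ℕ+} (τ : D.CyclotomeTower l Es)

/-- The inclusion `Π^tp_Y̲̲ ↪ Π^tp_X` (two open subgroups deep) is an open embedding.
[cite: MochizukiEtTh2009, Def 2.13 p.47] -/
theorem isOpenEmbedding_PiY_val (hC : D.Compat) (hS : D.Sec2Hyps) :
    Topology.IsOpenEmbedding
      (fun y : (C.thetaEnvTower τ hC hS).PiY => (((y : C.Huu) : D.PiTemp))) :=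
  C.isOpen_Huu.isOpenEmbedding_subtypeVal.comp
    (C.thetaEnvTower τ hC hS).PiY_open.isOpenEmbedding_subtypeVal

/-- `Π^tp_Y̲̲ → G_K` is onto at every level of the tower ("`G_K ≅ Π_X̲̲/Δ_X̲̲`", `map_aug_Ydduu`; the
level-`N` statement is abc-iut-L2-t10's `DoubleUnderline.augY_surjective`, of which this is a local
copy to keep the import graph small). [cite: MochizukiEtTh2009, Prop 2.2 (iii) p.37] -/
private theorem augY_surjective_level (hC : D.Compat) (hS : D.Sec2Hyps) (M : Es) :
    Function.Surjective ((C.thetaEnvTower τ hC hS).level M).augY := by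
  intro γ
  obtain ⟨k, hk⟩ := C.exists_lift γ
  refine ⟨⟨⟨(k : D.PiTemp), (Subgroup.mem_inf.1 k.2).2⟩,
    D.GtpYdd_le_GtpY (Subgroup.mem_inf.1 k.2).1⟩, Subtype.ext hk⟩

/-- `Π^tp_Y̲̲ → G_K` is continuous. [cite: MochizukiEtTh2009, Def 2.13 p.47] -/
theorem continuous_augY (hC : D.Compat) (hS : D.Sec2Hyps) (M : Es) :
    Continuous ((C.thetaEnvTower τ hC hS).level M).augY :=
  Continuous.subtype_mk (D.aug.continuous.comp (C.isOpenEmbedding_PiY_val τ hC hS).continuous) _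

/-- **Kummer lifting `(hKL)` for the MODEL tower** `thetaEnvTower C τ hC hS` (levels = the §1 data of
`X̲̲`, `G = G_K ≤ G_{ℚ_p}`, `μ_M ⊆ ℚ̄_p^×`, reductions = power maps): a Kummer shift of `Π^tp_Y̲̲[μ_M]`
by a cocycle inflated from `G_K` which is an automorphism of the TOPOLOGICAL group lifts, along
`μ_{M'} ↠ μ_M`, to such a shift of `Π^tp_Y̲̲[μ_{M'}]` — GIVEN `haugOpen` (`Π^tp_X → G_K` open), used only
to descend continuity from `Π^tp_Y̲̲` to `G_K`. This is the hypothesis `hKL` of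
`ThetaEnvTower.cor218_iv_reduction_of` (p.61: "the subgroup of `Out(Π_Y[μ_N])` generated by …
`K^× → H¹(G_K, μ_N)`", the Kummer map being compatible with `N ∣ N'`).
[cite: MochizukiEtTh2009, Cor 2.18 (iv) p.61] -/
theorem kummerLift_thetaEnvTower (hC : D.Compat) (hS : D.Sec2Hyps)
    (haugOpen : IsOpenMap D.aug)
    (M M' : Es) (h : (M : ℕ+) ∣ M')
    (δ : (C.thetaEnvTower τ hC hS).G → (C.thetaEnvTower τ hC hS).mu M)
    (hδ : CycEnvelope.IsEnvCocycle ((C.thetaEnvTower τ hC hS).level M).augY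
      ((C.thetaEnvTower τ hC hS).level M).chi (δ ∘ ((C.thetaEnvTower τ hC hS).level M).augY))
    (hsh : CycEnvelope.shift hδ ∈ contMulAut ((C.thetaEnvTower τ hC hS).level M).env) :
    ∃ (δ' : (C.thetaEnvTower τ hC hS).G → (C.thetaEnvTower τ hC hS).mu M')
      (hδ' : CycEnvelope.IsEnvCocycle ((C.thetaEnvTower τ hC hS).level M').augY
        ((C.thetaEnvTower τ hC hS).level M').chi (δ' ∘ ((C.thetaEnvTower τ hC hS).level M').augY)),
      CycEnvelope.shift hδ' ∈ contMulAut ((C.thetaEnvTower τ hC hS).level M').env ∧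
        ∀ g, (C.thetaEnvTower τ hC hS).red M M' h (δ' g) = δ g := by
  -- (1) the inflated cocycle `δ ∘ augY` is continuous on `Π^tp_Y̲̲`
  have hε : Continuous (δ ∘ ((C.thetaEnvTower τ hC hS).level M).augY) := by
    have heq : (δ ∘ ((C.thetaEnvTower τ hC hS).level M).augY) = fun y =>
        (CycEnvelope.shift hδ (CycEnvelope.algSection ((C.thetaEnvTower τ hC hS).level M).augY
          ((C.thetaEnvTower τ hC hS).level M).chi y)).left := by
      funext y
      simp only [Function.comp_apply, CycEnvelope.shift_apply, SemidirectProduct.left_inr,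
        SemidirectProduct.right_inr, one_mul]
    rw [heq]
    exact ((C.thetaEnvTower τ hC hS).level M).continuous_left.comp
      (hsh.1.comp ((C.thetaEnvTower τ hC hS).level M).continuous_algSection)
  -- (2) its kernel is open in `Π^tp_Y̲̲`, hence (via `haugOpen`) the kernel of `δ` is open in `G_K`
  have hU : IsOpen ((δ ∘ ((C.thetaEnvTower τ hC hS).level M).augY) ⁻¹' {1}) :=
    (isOpen_discrete _).preimage hε
  have hopenG : IsOpen {g : D.GK | δ g = 1} := by
    have hV := (haugOpen _ ((C.isOpenEmbedding_PiY_val τ hC hS).isOpenMap _ hU)).preimage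
      (continuous_subtype_val : Continuous (Subtype.val : D.GK → GQp p))
    convert hV using 1
    ext γ
    constructor
    · intro hγ
      obtain ⟨y, rfl⟩ := augY_surjective_level C τ hC hS M γ
      exact ⟨_, ⟨y, hγ, rfl⟩, rfl⟩
    · rintro ⟨_, ⟨y, hy, rfl⟩, h⟩
      have hy' : ((C.thetaEnvTower τ hC hS).level M).augY y = γ := Subtype.ext h
      rw [Set.mem_setOf_eq, ← hy']
      exact hy
  -- (3) `δ` is a cocycle on `G_K` (`augY` onto)
  have hδG : ∀ g g' : D.GK, δ (g * g') = δ g * galMuN p M (g : GQp p) (δ g') := by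
    intro g g'
    obtain ⟨y, rfl⟩ := augY_surjective_level C τ hC hS M g
    obtain ⟨y', rfl⟩ := augY_surjective_level C τ hC hS M g'
    have := hδ y y'
    simp only [Function.comp_apply] at this
    rw [map_mul] at this
    exact this
  -- (4) Kummer lifting on `G_K`
  obtain ⟨δ', hδ'c, hcont, hred⟩ := D.exists_kummer_lift_GK (pnat_dvd h) δ hδG hopenG
  have hδ' : CycEnvelope.IsEnvCocycle ((C.thetaEnvTower τ hC hS).level M').augY
      ((C.thetaEnvTower τ hC hS).level M').chi
      (δ' ∘ ((C.thetaEnvTower τ hC hS).level M').augY) := fun y y' => by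
    simp only [Function.comp_apply]
    rw [map_mul]
    exact hδ'c _ _
  exact ⟨δ', hδ', (C.thetaEnvTower τ hC hS).shift_mem_contMulAut M' hδ'
    (hcont.comp (C.continuous_augY τ hC hS M')), hred⟩

/-- Temp-slimness of `Π^tp_X` ("every open subgroup has trivial centraliser", [SemiAnbd] Ex. 3.10, the
tree's `IsSlimGroup`) restricts to the open subgroup `Π^tp_X̲̲` in the form `(hts)` consumed by the §2
discharge files. [cite: MochizukiEtTh2009, Cor 2.18 (iii) p.61] -/
theorem tempSlim_Huu (hslimX : IsSlimGroup D.PiTemp) :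
    ∀ U : Subgroup C.Huu, IsOpen (U : Set C.Huu) →
      ∀ z : C.Huu, (∀ u ∈ U, z * u = u * z) → z = 1 := by
  intro U hU z hz
  have hUo : IsOpen ((U.map C.Huu.subtype : Subgroup D.PiTemp) : Set D.PiTemp) := by
    rw [Subgroup.coe_map]
    exact C.isOpen_Huu.isOpenEmbedding_subtypeVal.isOpenMap _ hU
  have hmem : (z : D.PiTemp) ∈ Subgroup.centralizer
      ((U.map C.Huu.subtype : Subgroup D.PiTemp) : Set D.PiTemp) := by
    rw [Subgroup.mem_centralizer_iff]
    rintro _ ⟨u, hu, rfl⟩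
    exact (congrArg Subtype.val (hz u hu)).symm
  rw [hslimX.centralizer_eq_bot _ hUo, Subgroup.mem_bot] at hmem
  exact Subtype.ext hmem

/-- **Cor. 2.18 (iv), reduction clause, FOR THE §1 MODEL TOWER**: every automorphism of the model
mono-theta environment `M_{M'}(η')` of `X̲̲` induces one of `M_M(red ∘ η')` (`M ∣ M'`) — the named fact
`ThetaEnvTower.Cor218_iv_reduction` HOLDS for `thetaEnvTower C τ hC hS`, modulo temp-slimness of
`Π^tp_X` (interface FACT) and openness of `Π^tp_X → G_K` (`haugOpen`).
[cite: MochizukiEtTh2009, Cor 2.18 (iv) p.61] -/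
theorem cor218_iv_reduction_model (hC : D.Compat) (hS : D.Sec2Hyps) (hslimX : IsSlimGroup D.PiTemp)
    (haugOpen : IsOpenMap D.aug) :
    (C.thetaEnvTower τ hC hS).Cor218_iv_reduction :=
  (C.thetaEnvTower τ hC hS).cor218_iv_reduction_of (C.tempSlim_Huu hslimX)
    (C.kummerLift_thetaEnvTower τ hC hS haugOpen)

/-- **Cor. 2.19 (ii) (discrete rigidity) FOR THE §1 MODEL TOWER**: any projective system of mono-theta
environments of `X̲̲` (levels `M ∈ E`) is isomorphic to the natural one — the named fact
`ThetaEnvTower.Cor219_ii` HOLDS for `thetaEnvTower C τ hC hS`, modulo: temp-slimness of `Π^tp_X`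
(interface FACT, [SemiAnbd] Ex. 3.10), openness of `Π^tp_X → G_K` (`haugOpen`), and, at every level,
the Cor. 2.18 (iv) named facts `Cor218_iv_surjective` and `Cor218_iv_fibre` (first clause) of the
instantiated data (themselves reduced to Cor. 2.18 (i) / constant multiple rigidity — FACT-policy — and
Prop. 2.14 (i) by `Sec2LiftingSurjProofs.lean` / `Sec2LiftingProofs.lean`). The Cor. 2.18 (iii) inputs,
`Cor218_iv_reduction` and Kummer lifting are theorems here. [cite: MochizukiEtTh2009, Cor 2.19 (ii) p.64] -/
theorem cor219_ii_model (hC : D.Compat) (hS : D.Sec2Hyps) (hslimX : IsSlimGroup D.PiTemp)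
    (haugOpen : IsOpenMap D.aug)
    (hlift : ∀ M : Es, ((C.thetaEnvTower τ hC hS).level M).Cor218_iv_surjective)
    (hfib : ∀ M : Es, ((C.thetaEnvTower τ hC hS).level M).Cor218_iv_fibre) :
    (C.thetaEnvTower τ hC hS).Cor219_ii :=
  (C.thetaEnvTower τ hC hS).cor219_ii_of_tempSlim_kummerLift (C.tempSlim_Huu hslimX)
    (C.kummerLift_thetaEnvTower τ hC hS haugOpen) (fun M => hlift M) (fun M η hη α => (hfib M η hη).1 α)

/-- **Cor. 2.19 (ii) FOR THE §1 MODEL TOWER, `RigidData` form**: the same with the level-wise inputs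
taken on abc-iut-L2-t8's instantiated rigidity data `rigidData` (whose underlying environment data ARE
the levels of the tower): Cor. 2.18 (iv) surjectivity (`RigidData.Cor218_iv_surjective`; ⟸ Cor. 2.18
(i), (ii) + constant multiple rigidity by abc-iut-L2-t10's `cor218_iv_surjective_of`) and Prop. 2.14 (i)
(`RigidData.Prop214_i`; ⟸ `G_K` centre-free + the Heisenberg description of `l·Δ_Θ` by
`prop214_i_of_commutators`), the fibre clause of Cor. 2.18 (iv) being abc-iut-L2-t10's THEOREM
`cor218_iv_fibre_of_prop214_i`. [cite: MochizukiEtTh2009, Cor 2.19 (ii) p.64] -/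
theorem cor219_ii_model_of_rigid (hC : D.Compat) (hS : D.Sec2Hyps) (h15 : Prop15iii E hC)
    (L : C.CuspLabels) (hslimX : IsSlimGroup D.PiTemp)
    (haugOpen : IsOpenMap D.aug)
    (hlift : ∀ M : Es, (C.rigidData (τ.mod M) hC hS h15 L).Cor218_iv_surjective)
    (h214i : ∀ M : Es, (C.rigidData (τ.mod M) hC hS h15 L).Prop214_i) :
    (C.thetaEnvTower τ hC hS).Cor219_ii :=
  C.cor219_ii_model τ hC hS hslimX haugOpen
    (fun M => (RigidData.cor218_iv_surjective_iff _).1 (hlift M))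
    (fun M => (RigidData.cor218_iv_fibre_iff _).1
      ((C.rigidData (τ.mod M) hC hS h15 L).cor218_iv_fibre_of_prop214_i (h214i M)))

/-- **Cor. 2.19 (ii), strong form, FOR THE §1 MODEL TOWER**: any projective system of mono-theta
environments of `X̲̲` is isomorphic, compatibly with the reductions, to the natural system of ANY
compatible family of theta cocycles `η₀` — abc-iut-L2-d1 gen 0's `exists_iso_of_systems_tempSlim` with
temp-slimness restricted from `Π^tp_X` and Kummer lifting PROVED; remaining inputs: `haugOpen`, and
level-wise `Cor218_iv_surjective`, `Cor218_iv_fibre`, `Cor218_ii`. [cite: MochizukiEtTh2009, Cor 2.19 (ii) p.64] -/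
theorem exists_iso_of_systems_model (hC : D.Compat) (hS : D.Sec2Hyps) (hslimX : IsSlimGroup D.PiTemp)
    (haugOpen : IsOpenMap D.aug)
    (hlift : ∀ M : Es, ((C.thetaEnvTower τ hC hS).level M).Cor218_iv_surjective)
    (hfib : ∀ M : Es, ((C.thetaEnvTower τ hC hS).level M).Cor218_iv_fibre)
    (h218ii : ∀ M : Es, ((C.thetaEnvTower τ hC hS).level M).Cor218_ii)
    (S : (C.thetaEnvTower τ hC hS).MTESystem)
    (η₀ : ∀ M : Es, (C.thetaEnvTower τ hC hS).PiYdd → (C.thetaEnvTower τ hC hS).mu M)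
    (hη₀ : ∀ M, η₀ M ∈ (C.thetaEnvTower τ hC hS).thetaCocycles M)
    (hη₀c : ∀ (M M' : Es) (h : (M : ℕ+) ∣ M'), (C.thetaEnvTower τ hC hS).red M M' h ∘ η₀ M' = η₀ M) :
    ∃ α : ∀ M : Es, (((C.thetaEnvTower τ hC hS).level M).modelMono (hη₀ M)).Iso
        (((C.thetaEnvTower τ hC hS).level M).modelMono (S.mem M)),
      ∀ (M M' : Es) (h : (M : ℕ+) ∣ M') (x : ((C.thetaEnvTower τ hC hS).level M').env),
        S.a M M' h ((C.thetaEnvTower τ hC hS).redEnv M M' h ((α M').e x)) =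
          (α M).e ((C.thetaEnvTower τ hC hS).redEnv M M' h x) :=
  (C.thetaEnvTower τ hC hS).exists_iso_of_systems_tempSlim (C.tempSlim_Huu hslimX)
    (C.kummerLift_thetaEnvTower τ hC hS haugOpen) hlift hfib h218ii S η₀ hη₀ hη₀c

variable {N : ℕ+} (μ : D.CyclotomeMod l N)

/-- **Cor. 2.19 (i), subquotients, FOR THE §1 MODEL** (abc-iut-L2-t8's `rigidData` of `X̲̲` at level
`N`): every automorphism of the model mono-theta environment preserves `Π_{μ_N}` and `(l·Δ_Θ)[μ_N]` —
gen 0's `cor219_i_subquotients_of_tempSlim` with temp-slimness restricted from `Π^tp_X`; remaining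
input: Cor. 2.18 (i) (`RigidData.Cor218_i`, FACT-policy). [cite: MochizukiEtTh2009, Cor 2.19 (i) p.64] -/
theorem cor219_i_subquotients_model (hC : D.Compat) (hS : D.Sec2Hyps) (h15 : Prop15iii E hC)
    (L : C.CuspLabels) (hslimX : IsSlimGroup D.PiTemp)
    (h218i : (C.rigidData μ hC hS h15 L).Cor218_i) :
    (C.rigidData μ hC hS h15 L).Cor219_i_subquotients :=
  (C.rigidData μ hC hS h15 L).cor219_i_subquotients_of_tempSlim h218i (C.tempSlim_Huu hslimX)

/-- **Cor. 2.19 (i), splittings (cyclotomic rigidity), FOR THE §1 MODEL**: every automorphism of the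
model mono-theta environment of `X̲̲` is compatible with the two splittings of
`(l·Δ_Θ)[μ_N] ↠ (l·Δ_Θ)` — gen 0's `cor219_i_splittings_of_tempSlim` with temp-slimness restricted from
`Π^tp_X`; remaining inputs: Cor. 2.18 (i) (FACT-policy) and Prop. 2.14 (i) for the model.
[cite: MochizukiEtTh2009, Cor 2.19 (i) p.64] -/
theorem cor219_i_splittings_model (hC : D.Compat) (hS : D.Sec2Hyps) (h15 : Prop15iii E hC)
    (L : C.CuspLabels) (hslimX : IsSlimGroup D.PiTemp)
    (h218i : (C.rigidData μ hC hS h15 L).Cor218_i) (h214i : (C.rigidData μ hC hS h15 L).Prop214_i) :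
    (C.rigidData μ hC hS h15 L).Cor219_i_splittings :=
  (C.rigidData μ hC hS h15 L).cor219_i_splittings_of_tempSlim h218i (C.tempSlim_Huu hslimX) h214i

end ThetaSetting.EtaleThetaData.DoubleUnderline

end Literature.AnabelianGeometry.EtaleTheta

end
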